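import Summits.Parity.GeneralizedHardyLittlewood.Theorems.FordMaynardNoSieveConst0164NegWitness0164CellFaces

/-!
# Route `FordMaynardNoSieveConst0164`, crux `NegWitness0164` (stmt-Parity-19102), line `birth`,
# stub `stub_tweakNeg0164`: enclosure layer — section moments of the unit box, inner integrals

Helper file toward the certificate stub (K. Ford, J. Maynard, *On the theory of prime producing sieves*,
arXiv:2407.14368, §8).  After `cell_integral_le_unitbox_0164` (`…CellUnitBox`) every cell integral of an α-family of
(II') is bounded by `w²` times a polynomial slice integral over the symmetric unit box `(0,1)³ ∩ Δ₃(s)`, i.e. by a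
combination of the SECTION MOMENTS `M_{abc}(s) = ∫_{Δ₃(s)} 𝟙[u ∈ (0,1)³] u₀^a u₁^b u₂^c` (`a,b,c ≤ 2`), which are
piecewise polynomials in `s` (pieces `[0,1]`, `[1,2]`, `[2,3]`; this hand's census lists the 27 × 3 exact polynomials,
validated numerically).  Peeling the last coordinate (`sliceIntegral_succ_succ_snoc`) reduces `M_{abc}` to a
one-dimensional integral of `t^c · N_{ab}(s − t)` with the INNER moments
`N_{ab}(r) = ∫_{(0,r)} 𝟙[0 < x < 1, 0 < r − x < 1] x^a (r − x)^b dx`.  This file computes the inner layer: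

* `inner_window_low/high/off_0164` — the window `𝟙[0<x<1, 0<r−x<1]` on `(0,r)` is all of `(0,r)` for `r ≤ 1`,
  the interval `(r−1, 1)` for `1 ≤ r ≤ 2`, and empty for `r ≥ 2` (any integrand);
* `integral_pow_mul_sub_pow_a_b_0164` (`a, b ≤ 2`) — the nine antiderivatives `∫_{lo}^{hi} x^a (r−x)^b dx`.

Def-free.  References: [FordMaynard2024PrimeSieves] arXiv:2407.14368, §8 (proof of Theorem 2.7 (c)); folklore calculus.
-/

noncomputable section

open Finset MeasureTheory Set intervalIntegral
open scoped Classical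
open Literature.NumberTheory.Sieve Literature.NumberTheory.Sieve.FordMaynard

namespace Summit.Parity.GeneralizedHardyLittlewood.FordMaynardNoSieveConst0164NegWitness0164

/-- **Inner window, low range**: for `0 < r ≤ 1` the constraints `0 < x < 1`, `0 < r − x < 1` hold on all of `(0, r)`.
[folklore] -/
theorem inner_window_low_0164 {r : ℝ} (hr0 : 0 < r) (hr1 : r ≤ 1) (f : ℝ → ℝ) :
    (∫ x in Ioo 0 r, (if (0 < x ∧ x < 1) ∧ (0 < r - x ∧ r - x < 1) then f x else 0)) = ∫ x in (0 : ℝ)..r, f x := by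
  rw [setIntegral_congr_fun measurableSet_Ioo (fun x hx => by
    rw [if_pos ⟨⟨hx.1, by linarith [hx.2]⟩, ⟨by linarith [hx.2], by linarith [hx.1]⟩⟩]),
    ← integral_Ioc_eq_integral_Ioo, ← intervalIntegral.integral_of_le hr0.le]

/-- **Inner window, high range**: for `1 ≤ r ≤ 2` the constraints cut `(0, r)` down to `(r − 1, 1)`. [folklore] -/
theorem inner_window_high_0164 {r : ℝ} (hr1 : 1 ≤ r) (hr2 : r ≤ 2) (f : ℝ → ℝ) :
    (∫ x in Ioo 0 r, (if (0 < x ∧ x < 1) ∧ (0 < r - x ∧ r - x < 1) then f x else 0)) =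
      ∫ x in (r - 1 : ℝ)..1, f x := by
  have hfun : ∀ x ∈ Ioo (0 : ℝ) r, (if (0 < x ∧ x < 1) ∧ (0 < r - x ∧ r - x < 1) then f x else 0) =
      (Ioo (r - 1) 1).indicator f x := by
    intro x hx
    by_cases h : x ∈ Ioo (r - 1) 1
    · rw [Set.indicator_of_mem h, if_pos ⟨⟨hx.1, h.2⟩, ⟨by linarith [hx.2], by linarith [h.1]⟩⟩]
    · rw [Set.indicator_of_notMem h, if_neg]
      rintro ⟨⟨_, h2⟩, ⟨_, h4⟩⟩
      exact h ⟨by linarith, h2⟩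
  rw [setIntegral_congr_fun measurableSet_Ioo hfun, setIntegral_indicator measurableSet_Ioo,
    show Ioo (0 : ℝ) r ∩ Ioo (r - 1) 1 = Ioo (r - 1) 1 from
      Set.inter_eq_right.2 fun x hx => ⟨by linarith [hx.1], by linarith [hx.2]⟩,
    ← integral_Ioc_eq_integral_Ioo, ← intervalIntegral.integral_of_le (by linarith)]

/-- **Inner window, off range**: for `r ≥ 2` the constraints are void on `(0, r)`. [folklore] -/
theorem inner_window_off_0164 {r : ℝ} (hr2 : 2 ≤ r) (f : ℝ → ℝ) :
    (∫ x in Ioo 0 r, (if (0 < x ∧ x < 1) ∧ (0 < r - x ∧ r - x < 1) then f x else 0)) = 0 := by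
  rw [setIntegral_congr_fun measurableSet_Ioo (g := fun _ => (0 : ℝ)) (fun x hx => by
    rw [if_neg]
    rintro ⟨⟨_, h2⟩, ⟨_, h4⟩⟩
    linarith)]
  simp

/-- Antiderivative: `∫_{lo}^{hi} x^0 (r − x)^0 dx` in closed form. [folklore] -/
theorem integral_pow_mul_sub_pow_0_0_0164 (lo hi : ℝ) :
    (∫ x in lo..hi, x ^ 0) = (hi ^ 1 / 1) - (lo ^ 1 / 1) := by
  have hderiv : ∀ x : ℝ, HasDerivAt (fun x : ℝ => x ^ 1 / 1) (x ^ 0) x := by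
    intro x
    have h0 := ((hasDerivAt_pow 1 x).const_mul ((1 : ℝ))).div_const (1 : ℝ)
    refine ((h0.congr_of_eventuallyEq ?_).congr_deriv ?_)
    · exact Filter.Eventually.of_forall fun y => by ring
    · push_cast; ring
  rw [intervalIntegral.integral_eq_sub_of_hasDerivAt (fun x _ => hderiv x)
    ((by fun_prop : Continuous fun x : ℝ => x ^ 0).intervalIntegrable _ _)]

/-- Antiderivative: `∫_{lo}^{hi} x^0 (r − x)^1 dx` in closed form. [folklore] -/
theorem integral_pow_mul_sub_pow_0_1_0164 (r lo hi : ℝ) :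
    (∫ x in lo..hi, (r - x)) = (r * hi ^ 1 / 1 - hi ^ 2 / 2) - (r * lo ^ 1 / 1 - lo ^ 2 / 2) := by
  have hderiv : ∀ x : ℝ, HasDerivAt (fun x : ℝ => r * x ^ 1 / 1 - x ^ 2 / 2) ((r - x)) x := by
    intro x
    have h0 := ((hasDerivAt_pow 1 x).const_mul (r)).div_const (1 : ℝ)
    have h1 := ((hasDerivAt_pow 2 x).const_mul ((1 : ℝ))).div_const (2 : ℝ)
    refine (((h0.sub h1).congr_of_eventuallyEq ?_).congr_deriv ?_)
    · exact Filter.Eventually.of_forall fun y => by simp only [Pi.sub_apply]; ring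
    · push_cast; ring
  rw [intervalIntegral.integral_eq_sub_of_hasDerivAt (fun x _ => hderiv x)
    ((by fun_prop : Continuous fun x : ℝ => (r - x)).intervalIntegrable _ _)]

/-- Antiderivative: `∫_{lo}^{hi} x^0 (r − x)^2 dx` in closed form. [folklore] -/
theorem integral_pow_mul_sub_pow_0_2_0164 (r lo hi : ℝ) :
    (∫ x in lo..hi, (r - x) ^ 2) = (r ^ 2 * hi ^ 1 / 1 - 2 * r * hi ^ 2 / 2 + hi ^ 3 / 3) - (r ^ 2 * lo ^ 1 / 1 - 2 * r * lo ^ 2 / 2 + lo ^ 3 / 3) := by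
  have hderiv : ∀ x : ℝ, HasDerivAt (fun x : ℝ => r ^ 2 * x ^ 1 / 1 - 2 * r * x ^ 2 / 2 + x ^ 3 / 3) ((r - x) ^ 2) x := by
    intro x
    have h0 := ((hasDerivAt_pow 1 x).const_mul (r ^ 2)).div_const (1 : ℝ)
    have h1 := ((hasDerivAt_pow 2 x).const_mul (r)).div_const (2 : ℝ)
    have h2 := ((hasDerivAt_pow 3 x).const_mul ((1 : ℝ))).div_const (3 : ℝ)
    refine ((((h0.sub (h1.const_mul (2 : ℝ))).add h2).congr_of_eventuallyEq ?_).congr_deriv ?_)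
    · exact Filter.Eventually.of_forall fun y => by simp only [Pi.add_apply, Pi.sub_apply]; ring
    · push_cast; ring
  rw [intervalIntegral.integral_eq_sub_of_hasDerivAt (fun x _ => hderiv x)
    ((by fun_prop : Continuous fun x : ℝ => (r - x) ^ 2).intervalIntegrable _ _)]

/-- Antiderivative: `∫_{lo}^{hi} x^1 (r − x)^0 dx` in closed form. [folklore] -/
theorem integral_pow_mul_sub_pow_1_0_0164 (lo hi : ℝ) :
    (∫ x in lo..hi, x) = (hi ^ 2 / 2) - (lo ^ 2 / 2) := by
  have hderiv : ∀ x : ℝ, HasDerivAt (fun x : ℝ => x ^ 2 / 2) (x) x := by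
    intro x
    have h0 := ((hasDerivAt_pow 2 x).const_mul ((1 : ℝ))).div_const (2 : ℝ)
    refine ((h0.congr_of_eventuallyEq ?_).congr_deriv ?_)
    · exact Filter.Eventually.of_forall fun y => by ring
    · push_cast; ring
  rw [intervalIntegral.integral_eq_sub_of_hasDerivAt (fun x _ => hderiv x)
    ((by fun_prop : Continuous fun x : ℝ => x).intervalIntegrable _ _)]

/-- Antiderivative: `∫_{lo}^{hi} x^1 (r − x)^1 dx` in closed form. [folklore] -/
theorem integral_pow_mul_sub_pow_1_1_0164 (r lo hi : ℝ) :
    (∫ x in lo..hi, x * (r - x)) = (r * hi ^ 2 / 2 - hi ^ 3 / 3) - (r * lo ^ 2 / 2 - lo ^ 3 / 3) := by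
  have hderiv : ∀ x : ℝ, HasDerivAt (fun x : ℝ => r * x ^ 2 / 2 - x ^ 3 / 3) (x * (r - x)) x := by
    intro x
    have h0 := ((hasDerivAt_pow 2 x).const_mul (r)).div_const (2 : ℝ)
    have h1 := ((hasDerivAt_pow 3 x).const_mul ((1 : ℝ))).div_const (3 : ℝ)
    refine (((h0.sub h1).congr_of_eventuallyEq ?_).congr_deriv ?_)
    · exact Filter.Eventually.of_forall fun y => by simp only [Pi.sub_apply]; ring
    · push_cast; ring
  rw [intervalIntegral.integral_eq_sub_of_hasDerivAt (fun x _ => hderiv x)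
    ((by fun_prop : Continuous fun x : ℝ => x * (r - x)).intervalIntegrable _ _)]

/-- Antiderivative: `∫_{lo}^{hi} x^1 (r − x)^2 dx` in closed form. [folklore] -/
theorem integral_pow_mul_sub_pow_1_2_0164 (r lo hi : ℝ) :
    (∫ x in lo..hi, x * (r - x) ^ 2) = (r ^ 2 * hi ^ 2 / 2 - 2 * r * hi ^ 3 / 3 + hi ^ 4 / 4) - (r ^ 2 * lo ^ 2 / 2 - 2 * r * lo ^ 3 / 3 + lo ^ 4 / 4) := by
  have hderiv : ∀ x : ℝ, HasDerivAt (fun x : ℝ => r ^ 2 * x ^ 2 / 2 - 2 * r * x ^ 3 / 3 + x ^ 4 / 4) (x * (r - x) ^ 2) x := by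
    intro x
    have h0 := ((hasDerivAt_pow 2 x).const_mul (r ^ 2)).div_const (2 : ℝ)
    have h1 := ((hasDerivAt_pow 3 x).const_mul (r)).div_const (3 : ℝ)
    have h2 := ((hasDerivAt_pow 4 x).const_mul ((1 : ℝ))).div_const (4 : ℝ)
    refine ((((h0.sub (h1.const_mul (2 : ℝ))).add h2).congr_of_eventuallyEq ?_).congr_deriv ?_)
    · exact Filter.Eventually.of_forall fun y => by simp only [Pi.add_apply, Pi.sub_apply]; ring
    · push_cast; ring
  rw [intervalIntegral.integral_eq_sub_of_hasDerivAt (fun x _ => hderiv x)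
    ((by fun_prop : Continuous fun x : ℝ => x * (r - x) ^ 2).intervalIntegrable _ _)]

/-- Antiderivative: `∫_{lo}^{hi} x^2 (r − x)^0 dx` in closed form. [folklore] -/
theorem integral_pow_mul_sub_pow_2_0_0164 (lo hi : ℝ) :
    (∫ x in lo..hi, x ^ 2) = (hi ^ 3 / 3) - (lo ^ 3 / 3) := by
  have hderiv : ∀ x : ℝ, HasDerivAt (fun x : ℝ => x ^ 3 / 3) (x ^ 2) x := by
    intro x
    have h0 := ((hasDerivAt_pow 3 x).const_mul ((1 : ℝ))).div_const (3 : ℝ)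
    refine ((h0.congr_of_eventuallyEq ?_).congr_deriv ?_)
    · exact Filter.Eventually.of_forall fun y => by ring
    · push_cast; ring
  rw [intervalIntegral.integral_eq_sub_of_hasDerivAt (fun x _ => hderiv x)
    ((by fun_prop : Continuous fun x : ℝ => x ^ 2).intervalIntegrable _ _)]

/-- Antiderivative: `∫_{lo}^{hi} x^2 (r − x)^1 dx` in closed form. [folklore] -/
theorem integral_pow_mul_sub_pow_2_1_0164 (r lo hi : ℝ) :
    (∫ x in lo..hi, x ^ 2 * (r - x)) = (r * hi ^ 3 / 3 - hi ^ 4 / 4) - (r * lo ^ 3 / 3 - lo ^ 4 / 4) := by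
  have hderiv : ∀ x : ℝ, HasDerivAt (fun x : ℝ => r * x ^ 3 / 3 - x ^ 4 / 4) (x ^ 2 * (r - x)) x := by
    intro x
    have h0 := ((hasDerivAt_pow 3 x).const_mul (r)).div_const (3 : ℝ)
    have h1 := ((hasDerivAt_pow 4 x).const_mul ((1 : ℝ))).div_const (4 : ℝ)
    refine (((h0.sub h1).congr_of_eventuallyEq ?_).congr_deriv ?_)
    · exact Filter.Eventually.of_forall fun y => by simp only [Pi.sub_apply]; ring
    · push_cast; ring
  rw [intervalIntegral.integral_eq_sub_of_hasDerivAt (fun x _ => hderiv x)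
    ((by fun_prop : Continuous fun x : ℝ => x ^ 2 * (r - x)).intervalIntegrable _ _)]

/-- Antiderivative: `∫_{lo}^{hi} x^2 (r − x)^2 dx` in closed form. [folklore] -/
theorem integral_pow_mul_sub_pow_2_2_0164 (r lo hi : ℝ) :
    (∫ x in lo..hi, x ^ 2 * (r - x) ^ 2) = (r ^ 2 * hi ^ 3 / 3 - 2 * r * hi ^ 4 / 4 + hi ^ 5 / 5) - (r ^ 2 * lo ^ 3 / 3 - 2 * r * lo ^ 4 / 4 + lo ^ 5 / 5) := by
  have hderiv : ∀ x : ℝ, HasDerivAt (fun x : ℝ => r ^ 2 * x ^ 3 / 3 - 2 * r * x ^ 4 / 4 + x ^ 5 / 5) (x ^ 2 * (r - x) ^ 2) x := by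
    intro x
    have h0 := ((hasDerivAt_pow 3 x).const_mul (r ^ 2)).div_const (3 : ℝ)
    have h1 := ((hasDerivAt_pow 4 x).const_mul (r)).div_const (4 : ℝ)
    have h2 := ((hasDerivAt_pow 5 x).const_mul ((1 : ℝ))).div_const (5 : ℝ)
    refine ((((h0.sub (h1.const_mul (2 : ℝ))).add h2).congr_of_eventuallyEq ?_).congr_deriv ?_)
    · exact Filter.Eventually.of_forall fun y => by simp only [Pi.add_apply, Pi.sub_apply]; ring
    · push_cast; ring
  rw [intervalIntegral.integral_eq_sub_of_hasDerivAt (fun x _ => hderiv x)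
    ((by fun_prop : Continuous fun x : ℝ => x ^ 2 * (r - x) ^ 2).intervalIntegrable _ _)]

end Summit.Parity.GeneralizedHardyLittlewood.FordMaynardNoSieveConst0164NegWitness0164

end
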